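/-
Copyright (c) 2026. All rights reserved.
Released under Apache 2.0 license as described in the file LICENSE.
Authors: abc-iut cell, wave-3 discharge seat abc-iut-L6-d2 (gen 4) ([AbsTopIII] Def 5.6 (i) / Prop 5.8 (i):
`Ob(TG⊢)` is inhabited — `G_E ∈ Ob(TG⊢)` for every finite `E ⊆ ℚ̄_p` —, and the printed recipe
"`p^f` = 1 + the cardinality of the prime-to-`p` torsion of `k^×`" checked in abc-iut-S1's model).
-/
import Literature.AnabelianGeometry.AbsoluteAnabelian.MonoAnalyticNonarchModel
import Literature.AnabelianGeometry.AbsoluteAnabelian.MonoAnalyticLogShellsSubProofs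
import HarnessLib

/-!
# [AbsTopIII] Def 5.6 (i): `Ob(TG⊢)` is inhabited; Prop 5.8 (i): "`p^f` = 1 + #(prime-to-`p` torsion of `k^×`)"

S. Mochizuki, *Topics in absolute anabelian geometry III*, J. Math. Sci. Univ. Tokyo 22 (2015)
[MochizukiAbsTopIII2015] (kurims manuscript, lit key `paper:url-5493eb38cbb7`).  Def 5.6 (i) p. 134:
`Ob(TG⊢)` = "the profinite groups isomorphic to the absolute Galois group of an MLF" — typed by
abc-iut-L4-t3 as `IsMLFGaloisType G := ∃ k, IsMLF k ∧ Nonempty (G ≃ₜ* G_k)` (`MonoAnalyticLogShells.lean`),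
the DOMAIN of the algorithm `MonoAnalyticNonarchAlgorithm.out` of Prop 5.8 (i)–(iii).  Prop 5.8 (i) p. 139
l. 33–35 (extraction lines p0139.txt): "a functorial “group-theoretic” algorithm for reconstructing the
residue characteristic `p` [...], the cardinality `p^f` of the residue field of `k` [i.e., by adding `1` to
the cardinality of the prime-to-`p` torsion of `k^×`], the absolute degree `[k : ℚ_p]` [...], the absolute
ramification index `e = [k : ℚ_p]/f`, and the order `p^m` of the subgroup of `p`-th power roots of unity
of `k^×`."

PROVED here (proof-only, no definitions):
* `isMLF_padic`, `isMLF_padicSubfield` — `ℚ_p` and every finite `E ⊆ ℚ̄_p` are MLFs (the cell's `IsMLF`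
  of `FundamentalExtension.lean`; with abc-iut-w5-d067's `Prop58ii.isMLF_of_finiteDimensional`);
* **`isMLFGaloisType_absoluteGaloisGrp`** — `G_E ∈ Ob(TG⊢)`: the FIRST inhabitant of `IsMLFGaloisType` in
  the tree (abc-iut-w5-d067's `Prop58ii.openSubgroup_isMLFGaloisType` transforms inhabitants; none was
  exhibited), i.e. NON-VACUITY of the domain of `MonoAnalyticNonarchAlgorithm.out` — needed to APPLY the
  inhabited algorithm (`MonoAnalyticNonarchAlgorithmModel.lean`, this seat) at the concrete `G_{K_v}` of
  [IUTchIII] Prop 1.2 (vi); `IsMLFGaloisType.of_isMLF` (`G_k ∈ Ob(TG⊢)` for every MLF `k`),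
  `IsMLFGaloisType.of_continuousMulEquiv` (`Ob(TG⊢)` is isomorphism-closed);
* **`residueCardMLF_eq_pow_residueDegree`** — the printed recipe for `p^f` is CORRECT in abc-iut-S1's normed
  model of an MLF `K` (`residueDegree p K`, [IUTchIV] Prop 1.4, the invariant consumed by the MODEL
  `MonoAnalyticNonarch.ofPadicSubfield`): abc-iut-L4-t4's elementary `residueCardMLF p K = #μ_{(p')}(K) + 1`
  ([AbsAnab] Prop 1.2.1 (v), `MLFGaloisGroups.lean`) equals `p ^ residueDegree p K`, via
  `primeToRootsOfUnity_eq_image_rootsOfUnity` (`μ_{(p')}(K) = μ_{p^f-1}(K)`, Teichmüller) and abc-iut-S1's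
  `card_rootsOfUnity_residueCard_sub_one`.  (The recipes `e = [k:ℚ_p]/f` and `p^m` ARE abc-iut-S1's
  `absRamificationIdx_mul_residueDegree` and `torsionPExp` / `card_torsionUnits`.)

HONEST FRAMING: classical; refereed pre-IUT anabelian geometry; nothing here bears on [IUTchIII] Cor. 3.12.
-/

set_option autoImplicit false

noncomputable section

namespace Literature.AnabelianGeometry.AbsoluteAnabelian

open Field
open Literature.IUT.LogVolume (residueDegree residueDegree_pos torsionUnits mem_torsionUnits_iff
  pow_residueCard_sub_one_eq_one_of_not_dvd_orderOf residueCard_sub_one_ne_zero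
  card_rootsOfUnity_residueCard_sub_one)
open scoped Literature.IUT.LogVolume

universe u

/-! ## `ℚ_p` and the finite `E ⊆ ℚ̄_p` are MLFs; `Ob(TG⊢)` is inhabited -/

/-- `ℚ_p` is an MLF ([AbsTopI] §0: "a finite field extension of `ℚ_p`" — of degree `1`; the cell's
`IsMLF`). [cite: MochizukiAbsTopIII2015, Def 5.6 (i) p. 134] -/
theorem isMLF_padic (p : ℕ) [Fact p.Prime] : IsMLF ℚ_[p] := by
  refine ⟨⟨p, inferInstance, RingHom.id _, ?_⟩⟩
  letI : Algebra ℚ_[p] ℚ_[p] := (RingHom.id ℚ_[p]).toAlgebra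
  exact Module.Finite.of_surjective (Algebra.linearMap ℚ_[p] ℚ_[p]) fun y => ⟨y, rfl⟩

/-- **`G_k ∈ Ob(TG⊢)` for every MLF `k`** (Def 5.6 (i), with the identity `G_k ⥲ G_k`).
[cite: MochizukiAbsTopIII2015, Def 5.6 (i) p. 134] -/
theorem IsMLFGaloisType.of_isMLF (k : Type u) [Field k] [CharZero k] (hk : IsMLF k) :
    IsMLFGaloisType (absoluteGaloisGrp k) :=
  ⟨k, inferInstance, inferInstance, hk, ⟨ContinuousMulEquiv.refl _⟩⟩

/-- `Ob(TG⊢)` is closed under isomorphisms of profinite groups. [cite: MochizukiAbsTopIII2015, Def 5.6 (i) p. 134] -/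
theorem IsMLFGaloisType.of_continuousMulEquiv {G H : ProfiniteGrp.{u}} (hH : IsMLFGaloisType H)
    (e : G ≃ₜ* H) : IsMLFGaloisType G := by
  obtain ⟨k, _, _, hk, ⟨eH⟩⟩ := hH
  exact ⟨k, inferInstance, inferInstance, hk, ⟨e.trans eH⟩⟩

section Subfield

variable {p : ℕ} [Fact p.Prime] (E : IntermediateField ℚ_[p] (PadicAlgCl p)) [FiniteDimensional ℚ_[p] E]

/-- A finite `E ⊆ ℚ̄_p` (the setting "`k_i ⊆ ℚ̄_p`" of [IUTchIV] Prop 1.1) is an MLF.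
[cite: MochizukiAbsTopIII2015, Def 5.6 (i) p. 134] -/
theorem isMLF_padicSubfield : IsMLF E :=
  Prop58ii.isMLF_of_finiteDimensional ℚ_[p] E (isMLF_padic p)

/-- **`G_E ∈ Ob(TG⊢)`** for every finite `E ⊆ ℚ̄_p`: NON-VACUITY of the domain `IsMLFGaloisType` of the
algorithm of Prop 5.8 (i)–(iii) (`MonoAnalyticNonarchAlgorithm.out`), at the very groups `G_{K_v}` where
[IUTchIII] Prop 1.2 (vi) applies it. [cite: MochizukiAbsTopIII2015, Def 5.6 (i) p. 134] -/
theorem isMLFGaloisType_absoluteGaloisGrp : IsMLFGaloisType (absoluteGaloisGrp E) :=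
  IsMLFGaloisType.of_isMLF E (isMLF_padicSubfield E)

/-- `Ob(TG⊢)` is nonempty (e.g. `G_{ℚ_p} = G_E` for `E = ℚ_p ⊆ ℚ̄_p`). [cite: MochizukiAbsTopIII2015, Def 5.6 (i) p. 134] -/
theorem exists_isMLFGaloisType : ∃ G : ProfiniteGrp.{0}, IsMLFGaloisType G :=
  ⟨absoluteGaloisGrp (⊥ : IntermediateField ℚ_[2] (PadicAlgCl 2)), isMLFGaloisType_absoluteGaloisGrp _⟩

end Subfield

/-! ## Prop 5.8 (i): "`p^f` = 1 + #(prime-to-`p` torsion of `k^×`)" in abc-iut-S1's model -/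

section NormedModel

variable (p : ℕ) [Fact p.Prime] (K : Type) [NontriviallyNormedField K] [NormedAlgebra ℚ_[p] K]
  [IsUltrametricDist K] [ProperSpace K]

/-- In abc-iut-S1's normed model of an MLF `K` (residue field of `p^f` elements): the roots of unity of
order prime to `p` are exactly the `(p^f - 1)`-th roots of unity — `μ_{(p')}(K) = μ_{q-1}(K)` (a root of
unity of order prime to `p` is killed by `q - 1`: Teichmüller; conversely `p ∤ q - 1`).
[cite: MochizukiAbsTopIII2015, Prop 5.8 (i) p. 139] -/
theorem primeToRootsOfUnity_eq_image_rootsOfUnity :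
    primeToRootsOfUnity p K =
      ((↑) : Kˣ → K) '' (rootsOfUnity (p ^ residueDegree p K - 1) K : Set Kˣ) := by
  have hp : p.Prime := Fact.out
  have hq1 : p ^ residueDegree p K - 1 ≠ 0 := residueCard_sub_one_ne_zero p K
  have hq : 1 ≤ p ^ residueDegree p K := Nat.one_le_pow _ _ hp.pos
  have hpq : ¬ p ∣ p ^ residueDegree p K - 1 := by
    intro h
    have hpp : p ∣ p ^ residueDegree p K := dvd_pow_self p (residueDegree_pos p K).ne'
    have h1 : p ∣ p ^ residueDegree p K - (p ^ residueDegree p K - 1) := Nat.dvd_sub hpp h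
    rw [Nat.sub_sub_self hq] at h1
    exact hp.one_lt.ne' (Nat.dvd_one.mp h1)
  ext ζ
  constructor
  · rintro ⟨n, hn, hpn, hζn⟩
    have hζ0 : ζ ≠ 0 := by
      rintro rfl
      rw [zero_pow hn.ne'] at hζn
      exact zero_ne_one hζn
    let u : Kˣ := Units.mk0 ζ hζ0
    have hu : u ∈ torsionUnits K := (mem_torsionUnits_iff K u).mpr ⟨n, hn, hζn⟩
    have hun : u ^ n = 1 := Units.ext (by rw [Units.val_pow_eq_pow_val, Units.val_one]; exact hζn)
    have hord : ¬ p ∣ orderOf u := fun hp' => hpn (hp'.trans (orderOf_dvd_of_pow_eq_one hun))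
    refine ⟨u, ?_, rfl⟩
    rw [SetLike.mem_coe, mem_rootsOfUnity]
    exact pow_residueCard_sub_one_eq_one_of_not_dvd_orderOf p K hu hord
  · rintro ⟨u, hu, rfl⟩
    rw [SetLike.mem_coe, mem_rootsOfUnity] at hu
    refine ⟨p ^ residueDegree p K - 1, Nat.pos_of_ne_zero hq1, hpq, ?_⟩
    rw [← Units.val_pow_eq_pow_val, hu, Units.val_one]

/-- **`#μ_{(p')}(K) = p^f - 1`** in abc-iut-S1's normed model (`card_rootsOfUnity_residueCard_sub_one`:
`K` contains the `(q-1)`-th roots of unity, Teichmüller). [cite: MochizukiAbsTopIII2015, Prop 5.8 (i) p. 139] -/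
theorem natCard_primeToRootsOfUnity_eq_pow_sub_one :
    Nat.card (primeToRootsOfUnity p K) = p ^ residueDegree p K - 1 := by
  rw [primeToRootsOfUnity_eq_image_rootsOfUnity p K, Nat.card_coe_set_eq,
    Set.ncard_image_of_injective _ Units.val_injective, ← Nat.card_coe_set_eq]
  exact card_rootsOfUnity_residueCard_sub_one p K

/-- **Prop 5.8 (i), the printed recipe for `p^f`, checked**: "the cardinality `p^f` of the residue field of
`k` [i.e., by adding `1` to the cardinality of the prime-to-`p` torsion of `k^×`]" — abc-iut-L4-t4's
elementary `residueCardMLF p K := #μ_{(p')}(K) + 1` equals `p ^ residueDegree p K` for the residue degree of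
abc-iut-S1's normed model (`card_residueField : #(𝒪/𝔪) = p^f`).
[cite: MochizukiAbsTopIII2015, Prop 5.8 (i) p. 139] -/
theorem residueCardMLF_eq_pow_residueDegree : residueCardMLF p K = p ^ residueDegree p K := by
  rw [residueCardMLF, natCard_primeToRootsOfUnity_eq_pow_sub_one p K]
  have := Nat.one_le_pow (residueDegree p K) p (Fact.out : p.Prime).pos
  omega

open scoped NormedField in
/-- Hence also `#μ_{(p')}(K) + 1 = #(𝒪_K/𝔪_K)`, the residue field cardinality itself (residue field of the
valuation ring `Valued.integer K` of the norm, abc-iut-S1's convention).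
[cite: MochizukiAbsTopIII2015, Prop 5.8 (i) p. 139] -/
theorem residueCardMLF_eq_card_residueField :
    residueCardMLF p K = Nat.card (IsLocalRing.ResidueField (Valued.integer K)) := by
  rw [residueCardMLF_eq_pow_residueDegree, Literature.IUT.LogVolume.card_residueField p K]

end NormedModel

end Literature.AnabelianGeometry.AbsoluteAnabelian

end
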